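import Literature.MathematicalPhysics.QuantumFieldTheory.Balaban1983to89.B10NodeKnit
import Summits.QuantumFields.Balaban3D.Proofs.NegativeEdge

/-!
# Route «BalabanUVNodes» (cluster K3), Track-A DAG node N08 = [Balaban1985UV3] Thm 1 p. 257 ∕ Thm 2 p. 272 — THE KNIT BY NAME
# ON THE CONCRETE d = 3 LATTICE APPROXIMATIONS of the `pub-balaban3d` lane (`Balaban1985CMP102.Setting.Scales`, tower carriers with
# `Balaban3D.Proofs.UVStability3D.ConcreteLeaves`), under both readings of the node's own leaf

Cell `pub-ymgap`, seat `pub-ymgap-dag-n08-a` (KNIT-BY-NAME; HUMAN RULING D-0062; chair R424 venue ∕ R429–R430; YM-PLAN v0.12.15 §2b row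
N08; dag-lead NODE-TABLE row n08).  `bears_on: R4∕N08`.  Filed `--supports stmt-QuantumFields-19183` (crux StabilityBAtRecord).
THEOREMS ONLY: def-free, sorry-free, standard axioms; everything analytic is an existing kernel theorem of the tree used BY NAME or an
explicit hypothesis.

WHAT N08 IS.  `Dag.B10_main (DagBinding.leavesP w P)` = «[B5] → [B6] → [B7] → [B8] → [B9] → [B11] conclusions ⇒ leaf b10» with, at
the N-binding of record `DagBinding.Upstream.ofPrintedAllXPN X Y Z V W`, `b10 = B10.Thm1Printed X.runs10 ∧ B10.Thm2Printed X.runs10`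
(LITERAL: one constant per bounded coupling set) — YM-PLAN §9 Q2 (OPEN) asks whether the COMPACT reading `DagDischarged.b10Compact X`
(one constant per compact coupling window, cell GAPS G-B10-01) is of record instead.  The Literature-side knit `…Balaban1983to89.B10NodeKnit`
(this seat, p408896) proved N08 under both readings at a binding whose B10 runs are ABSTRACT tower runs carrying `B10Assembly.LeafSystem`s.

WHAT THIS FILE ADDS — THE SAME ON CONCRETE CARRIERS.  The `pub-balaban3d` lane typed [Balaban1985UV3]'s OWN objects: the lattice
approximations `S : Scales L` (torus `T_ε`, spacing ε, `K` steps with `L^Kε = ε₀`, coupling g; `g_k = g(L^kε)^{1/2}`, `|T₁^{(k)}|`), tower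
carriers `T : B10.TowerRun` over them, and the bundle `UVStability3D.ConcreteLeaves C S T` = the carrier equations (rfl-level for the lane's
`Carriers.Tower.tower3`) + the ANALYTIC LEAVES of Sects. A∕C∕D (`AnalyticLeaves`: (1) at k = 0, the fourteen step leaves per k < K, (46),
(65)'s inputs, the large-field control (67)–(71)+[9] §3.C — HYPOTHESES, owned by that lane's seats p1–p6) from which
`UVStability3D.leafSystem_of_concrete` REBUILDS the 4D cell's `LeafSystem` with the thirteen arithmetic fields discharged.  Hence, for a
world whose B10 run family IS such a family of concrete towers (`X.withTowerRuns10 T`):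
* §1 (C) `b10_main_concrete_upCompact`: at the compact re-binding N08 HOLDS (in-edges unused) — on EVERY family, the ε → 0 one included;
  record-predicate form `b10_main_at_record_of_concretePin` (= dagwriter's `S_N08 Rec` shape for any `Rec` pinning runs10 this way).
* §2 (L, coarse) `b10_main_concrete_of_coarse`: at the literal binding N08 HOLDS on every sub-family whose BARE couplings `g₀² = g²ε`
  (`Scales.g0sq`) are bounded below (the rebuilt leaf system's spacing unit is `g₀²`, R-NORM).
* §3 (L, fine) `not_b10_main_concrete_of_fine` ∕ `b10_main_concrete_iff_inEdge_fails_of_fine`: with the reader's items (R1) unit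
  configuration, (R3) `d(𝔤) ≥ d₀ > 0` — (R2) DISCHARGED by the concrete star count (`B10StarLower`, via `NegativeEdge.not_thm1Printed_concrete`) —
  and arbitrarily small bare couplings in the family, the literal node FAILS as soon as its six in-edges hold; §4: the family of ALL
  `Scales L` is such (`NegativeEdge.scales_fine`).
HONEST FRAMING: count-neutral kernel bookkeeping by name over the b2b ∕ lit-balaban ∕ pub-balaban3d theorems; NOT a discharge (NODE 00 has
not pinned `runs10`; Q2 open; the analytic leaves are hypotheses); d = 3 lattice gauge theory on finite tori; nothing about d = 4, the
continuum, OS axioms, a mass gap or the Clay problem.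
-/

namespace Summit.QuantumFields.YangMills.Theorems.BalabanUVNodesN08Concrete

open Literature.MathematicalPhysics.QuantumFieldTheory.Balaban1983to89
open Literature.MathematicalPhysics.QuantumFieldTheory.Balaban1983to89.DagBinding
open Literature.MathematicalPhysics.QuantumFieldTheory.Balaban1983to89.DagDischargedII
open Literature.MathematicalPhysics.QuantumFieldTheory.Balaban1983to89.B10 (TowerRun Thm1Printed Thm2Printed)
open Literature.MathematicalPhysics.QuantumFieldTheory.Balaban1983to89.DagDischarged (b10Compact)
open Literature.MathematicalPhysics.QuantumFieldTheory.Balaban1985CMP102.Setting (Scales)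
open Summit.QuantumFields.Balaban3D.Proofs.Constants (NormalisedConsts)
open Summit.QuantumFields.Balaban3D.Proofs.UVStability3D (ConcreteLeaves leafSystem_of_concrete)
open Summit.QuantumFields.Balaban3D.Proofs.NegativeEdge (not_thm1Printed_concrete scales_fine)

variable {L : ℕ} {C : B10Assembly.Consts} (hC : NormalisedConsts L C) {I : Type} {S : I → Scales L} {T : I → TowerRun}
  (X : ∀ i, ConcreteLeaves C (S i) (T i)) {Xc : PrintedCarriersR} {Y : PrintedCarriers9X} {Z : PrintedCarriers11}
  {V : PrintedCarriers14R} {W : PrintedCarriers15} {w : WorldP} {P : B12.RunParams}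

/-! ## §1 The COMPACT reading on the concrete towers -/

include hC X in
/-- **N08 BY NAME, COMPACT READING, CONCRETE d = 3 TOWERS.**  For a family `T i` of tower carriers over lattice approximations `S i : Scales L`
carrying concrete leaf bundles with normalised family constants, at any world whose upstream at the run `P` is the N-binding over
`Xc.withTowerRuns10 T` with the one slot `b10` re-read as `b10Compact`: `Dag.B10_main (leavesP w P)` (in-edges unused; every family, the
ε → 0 one included).  `B10NodeKnit.b10_main_of_upCompact` ∘ `UVStability3D.leafSystem_of_concrete`. [cite: Balaban1985UV3, Thm 1 p.257 (compact reading) + Thm 2 p.272] -/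
theorem b10_main_concrete_upCompact
    (hupC : w.up P = { Upstream.ofPrintedAllXPN (Xc.withTowerRuns10 T) Y Z V W with
      b10 := b10Compact (Xc.withTowerRuns10 T).toPrintedCarriers }) :
    Dag.B10_main (leavesP w P) :=
  B10NodeKnit.b10_main_of_upCompact (fun i => leafSystem_of_concrete hC (X i)) hupC

/-- **Record-predicate form** (the shape of dagwriter's `S_N08 Rec := AtRecord Rec Dag.B10_main`): for ANY predicate `Rec` on binding worlds
under which, at every run, the upstream is the compact re-binding over carriers whose B10 runs are concrete towers with concrete leaf
bundles, N08 holds at every `Rec`-world and run.  What a NODE 00 B10-pin to the d = 3 lane's towers + the Q2 word (C) would instantiate,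
MODULO the lane's analytic leaves. [cite: Balaban1985UV3, Thm 1 p.257 + Thm 2 p.272 (bookkeeping shape)] -/
theorem b10_main_at_record_of_concretePin (Rec : WorldP → Prop)
    (hpin : ∀ w, Rec w → ∀ P : B12.RunParams,
      ∃ (Xc : PrintedCarriersR) (Y : PrintedCarriers9X) (Z : PrintedCarriers11) (V : PrintedCarriers14R) (W : PrintedCarriers15)
        (L : ℕ) (C : B10Assembly.Consts) (I : Type) (S : I → Scales L) (T : I → TowerRun),
        NormalisedConsts L C ∧ Nonempty (∀ i, ConcreteLeaves C (S i) (T i)) ∧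
          w.up P = { Upstream.ofPrintedAllXPN (Xc.withTowerRuns10 T) Y Z V W with
            b10 := b10Compact (Xc.withTowerRuns10 T).toPrintedCarriers }) :
    ∀ w, Rec w → ∀ P, Dag.B10_main (leavesP w P) := by
  intro w hw P
  obtain ⟨Xc, Y, Z, V, W, L, C, I, S, T, hC, ⟨X⟩, hupC⟩ := hpin w hw P
  exact b10_main_concrete_upCompact hC X hupC

/-! ## §2 The LITERAL reading on sub-families with bare couplings bounded below -/

include hC X in
/-- **N08 BY NAME, LITERAL READING, COARSE IN THE BARE COUPLING.**  If every approximation of the family has `g₀² = g²ε ≥ δ₀ > 0`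
(`Scales.g0sq`; the spacing unit of the rebuilt leaf system, lane ruling R-NORM), then at the (literal) N-binding over `Xc.withTowerRuns10 T`
N08 HOLDS (in-edges unused): `B10NodeKnit.b10_main_of_leafSystems_of_coarse`. [cite: Balaban1985UV3, Thm 1 p.257 + Thm 2 p.272] -/
theorem b10_main_concrete_of_coarse (hup : w.up P = Upstream.ofPrintedAllXPN (Xc.withTowerRuns10 T) Y Z V W) {δ₀ : ℝ}
    (hδ₀ : 0 < δ₀) (hcoarse : ∀ i, δ₀ ≤ (S i).g0sq) : Dag.B10_main (leavesP w P) :=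
  B10NodeKnit.b10_main_of_leafSystems_of_coarse (fun i => leafSystem_of_concrete hC (X i)) hup hδ₀ fun i => hcoarse i

include hC X in
/-- On such a coarse concrete family the two readings of Theorem 1 COINCIDE. [cite: Balaban1985UV3, Thm 1 p.257 (both readings)] -/
theorem thm1Printed_iff_thm1Compact_concrete_of_coarse {δ₀ : ℝ} (hδ₀ : 0 < δ₀) (hcoarse : ∀ i, δ₀ ≤ (S i).g0sq) :
    Thm1Printed (fun i => (T i).toRunData) ↔ B10.Thm1PrintedCompact (fun i => (T i).toRunData) :=
  B10NodeKnit.thm1Printed_iff_thm1Compact_of_coarse T (fun i => leafSystem_of_concrete hC (X i)) hδ₀ fun i => hcoarse i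

/-! ## §3 The LITERAL reading on families with arbitrarily small bare couplings — the negative edge at the node -/

include hC X in
/-- The literal `b10` leaf FAILS over concrete towers with arbitrarily small bare couplings, given (R1) the unit configuration at level 0 and
(R3) `d(𝔤) ≥ d₀ > 0` — (R2) is DISCHARGED by the concrete star count (`NegativeEdge.not_thm1Printed_concrete`, via `B10StarLower`).
[cite: Balaban1985UV3, Thm 1 p.257 (typing), (62) p.271, (18) p.260] -/
theorem not_b10Leaf_concrete_of_fine {d₀ : ℝ} (hd : 0 < d₀)
    (hD : ∀ (i : I) (k : ℕ) (hk : k + 1 ≤ (T i).K), d₀ ≤ ((X i).steps k hk).P.dg) (hU : ∀ i, B10DagLeaf.UnitConfig0 (T i))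
    (hfine : ∀ δ : ℝ, 0 < δ → ∃ i, 1 ≤ (S i).K ∧ (S i).g0sq < δ) :
    ¬ (Upstream.ofPrintedAllXPN (Xc.withTowerRuns10 T) Y Z V W).b10 := fun h =>
  not_thm1Printed_concrete C hC (fun i => (T i).toRunData) S T (fun _ => rfl) X hd hD hU hfine h.1

include hC X in
/-- **N08, LITERAL READING, FINE CONCRETE FAMILIES — THE NEGATIVE EDGE AT THE NODE**: with (R1), (R3) and arbitrarily small bare couplings,
at the literal N-binding over `Xc.withTowerRuns10 T` the node FAILS as soon as its six in-edge leaves hold. [cite: Balaban1985UV3, Thm 1 p.257 (typing), (62) p.271] -/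
theorem not_b10_main_concrete_of_fine (hup : w.up P = Upstream.ofPrintedAllXPN (Xc.withTowerRuns10 T) Y Z V W) {d₀ : ℝ}
    (hd : 0 < d₀) (hD : ∀ (i : I) (k : ℕ) (hk : k + 1 ≤ (T i).K), d₀ ≤ ((X i).steps k hk).P.dg)
    (hU : ∀ i, B10DagLeaf.UnitConfig0 (T i)) (hfine : ∀ δ : ℝ, 0 < δ → ∃ i, 1 ≤ (S i).K ∧ (S i).g0sq < δ)
    (h5 : (Upstream.ofPrintedAllXPN (Xc.withTowerRuns10 T) Y Z V W).b5)
    (h6 : (Upstream.ofPrintedAllXPN (Xc.withTowerRuns10 T) Y Z V W).b6)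
    (h7 : (Upstream.ofPrintedAllXPN (Xc.withTowerRuns10 T) Y Z V W).b7)
    (h8 : (Upstream.ofPrintedAllXPN (Xc.withTowerRuns10 T) Y Z V W).b8)
    (h9 : (Upstream.ofPrintedAllXPN (Xc.withTowerRuns10 T) Y Z V W).b9)
    (h11 : (Upstream.ofPrintedAllXPN (Xc.withTowerRuns10 T) Y Z V W).b11) :
    ¬ Dag.B10_main (leavesP w P) := fun h =>
  not_b10Leaf_concrete_of_fine hC X (Xc := Xc) (Y := Y) (Z := Z) (V := V) (W := W) hd hD hU hfine
    ((B10NodeKnit.b10_main_iff_of_up hup).1 h h5 h6 h7 h8 h9 h11)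

include hC X in
/-- The same as a DICHOTOMY: on a fine concrete family the literal node holds iff one of its six in-edges FAILS at the binding (it can only
hold vacuously — the plan's «XP-hazard» for this node, in kernel form on the paper's own carriers). [cite: Balaban1985UV3, Thm 1 p.257 (typing), (62) p.271] -/
theorem b10_main_concrete_iff_inEdge_fails_of_fine (hup : w.up P = Upstream.ofPrintedAllXPN (Xc.withTowerRuns10 T) Y Z V W)
    {d₀ : ℝ} (hd : 0 < d₀) (hD : ∀ (i : I) (k : ℕ) (hk : k + 1 ≤ (T i).K), d₀ ≤ ((X i).steps k hk).P.dg)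
    (hU : ∀ i, B10DagLeaf.UnitConfig0 (T i)) (hfine : ∀ δ : ℝ, 0 < δ → ∃ i, 1 ≤ (S i).K ∧ (S i).g0sq < δ) :
    Dag.B10_main (leavesP w P) ↔
      ¬ ((Upstream.ofPrintedAllXPN (Xc.withTowerRuns10 T) Y Z V W).b5 ∧
          (Upstream.ofPrintedAllXPN (Xc.withTowerRuns10 T) Y Z V W).b6 ∧
          (Upstream.ofPrintedAllXPN (Xc.withTowerRuns10 T) Y Z V W).b7 ∧
          (Upstream.ofPrintedAllXPN (Xc.withTowerRuns10 T) Y Z V W).b8 ∧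
          (Upstream.ofPrintedAllXPN (Xc.withTowerRuns10 T) Y Z V W).b9 ∧
          (Upstream.ofPrintedAllXPN (Xc.withTowerRuns10 T) Y Z V W).b11) := by
  have hleaf : ¬ (leavesP w P).b10 := by
    rw [B10NodeKnit.leavesP_b10, hup]
    exact not_b10Leaf_concrete_of_fine hC X hd hD hU hfine
  rw [B10NodeKnit.b10_main_iff_not_inEdges_of_not_leaf hleaf]
  show ¬ ((w.up P).b5 ∧ (w.up P).b6 ∧ (w.up P).b7 ∧ (w.up P).b8 ∧ (w.up P).b9 ∧ (w.up P).b11) ↔ _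
  rw [hup]

/-! ## §4 The family of ALL lattice approximations `Scales L` -/

section AllScales

variable {T' : Scales L → TowerRun} (X' : ∀ S : Scales L, ConcreteLeaves C S (T' S))

include hC X' in
/-- On the family of ALL lattice approximations (every ε, volume, K, g with `g²ε₀ ≤ 1`; it contains arbitrarily small bare couplings,
`NegativeEdge.scales_fine`), with (R1), (R3): the literal node at the N-binding over `Xc.withTowerRuns10 T'` holds iff an in-edge fails —
while the compact node holds outright (§1). [cite: Balaban1985UV3, Thm 1 p.257 (both readings), (62) p.271] -/
theorem b10_main_allScales_iff_inEdge_fails (hL : Odd L ∧ 1 < L)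
    (hup : w.up P = Upstream.ofPrintedAllXPN (Xc.withTowerRuns10 T') Y Z V W) {d₀ : ℝ} (hd : 0 < d₀)
    (hD : ∀ (S : Scales L) (k : ℕ) (hk : k + 1 ≤ (T' S).K), d₀ ≤ ((X' S).steps k hk).P.dg)
    (hU : ∀ S, B10DagLeaf.UnitConfig0 (T' S)) :
    Dag.B10_main (leavesP w P) ↔
      ¬ ((Upstream.ofPrintedAllXPN (Xc.withTowerRuns10 T') Y Z V W).b5 ∧
          (Upstream.ofPrintedAllXPN (Xc.withTowerRuns10 T') Y Z V W).b6 ∧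
          (Upstream.ofPrintedAllXPN (Xc.withTowerRuns10 T') Y Z V W).b7 ∧
          (Upstream.ofPrintedAllXPN (Xc.withTowerRuns10 T') Y Z V W).b8 ∧
          (Upstream.ofPrintedAllXPN (Xc.withTowerRuns10 T') Y Z V W).b9 ∧
          (Upstream.ofPrintedAllXPN (Xc.withTowerRuns10 T') Y Z V W).b11) :=
  b10_main_concrete_iff_inEdge_fails_of_fine hC X' hup hd hD hU fun δ hδ => scales_fine hL δ hδ

include hC X' in
/-- … and at the compact re-binding over the same family N08 holds. [cite: Balaban1985UV3, Thm 1 p.257 (compact reading) + Thm 2 p.272] -/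
theorem b10_main_allScales_upCompact
    (hupC : w.up P = { Upstream.ofPrintedAllXPN (Xc.withTowerRuns10 T') Y Z V W with
      b10 := b10Compact (Xc.withTowerRuns10 T').toPrintedCarriers }) :
    Dag.B10_main (leavesP w P) :=
  b10_main_concrete_upCompact hC X' hupC

end AllScales

end Summit.QuantumFields.YangMills.Theorems.BalabanUVNodesN08Concrete
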